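import Mathlib.GroupTheory.QuotientGroup.Basic
import Mathlib.GroupTheory.OrderOfElement
import HarnessLib

/-!
# Quotients by cyclic kernels: the algebra of Kervaire–Milnor's Lemma 5.6

Two elementary lemmas on abelian groups, recorded in general form because they are the whole
algebraic content of one printed argument: M. Kervaire, J. Milnor, *Groups of homotopy spheres I*,
Ann. of Math. (2) 77 (1963), **Lemma 5.6** (pp. 514–516). There `M₀ = M ∖ int φ(Sᵏ × Dᵏ⁺¹)`,
`M' = χ(M, φ)`, and the exact sequences of the pairs `(M, M₀)`, `(M', M₀)` (equivalently the
Mayer–Vietoris sequences of `M = M₀ ∪ tube`, `M' = M₀ ∪ handle`) show that `H_kM₀ → H_kM` is onto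
with kernel generated by the meridian class `ε'` and `H_kM₀ → H_kM'` is onto with kernel generated
by the parallel class `ε`; "From this diagram the isomorphisms
`H_kM/λ(Z) ≅ H_kM₀/ε(Z) + ε'(Z) ≅ H_kM'/λ'(Z)` are apparent" (p. 516), `λ = i(ε)`, `λ' = i'(ε')`.

* `surjective_and_ker_eq_zmultiples_of_mayerVietoris` — the diagram chase: from an exact
  `I → U ⊕ W → Y → 0` (given elementwise) in which `I` is generated by two classes `m`, `p` with
  `m ↦ 0` and `p ↦` a generator of infinite order in `W`, the map `U → Y` is onto with kernel
  exactly `mℤ` (read with `(m, p) = (ε', ε)` for `Y = H_kM`, `W = H_k(tube)`, and with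
  `(m, p) = (ε, ε')` for `Y = H_kM'`, `W = H_k(handle)`);
* `nonempty_quotient_zmultiples_addEquiv_of_ker_eq` — the "apparent" isomorphism: if `i : A → B`
  is onto with kernel `mℤ` and `j : A → C` is onto with kernel `pℤ` then `B/(i p)ℤ ≅ C/(j m)ℤ`.

Consumer: the middle-dimensional surgery files of `Literature/Topology/FourManifolds`
(Lemma 5.6 for the tree's `NullCobordism.surgery`). Everything is proved; no definitions.

## References

* M. Kervaire, J. Milnor, *Groups of homotopy spheres I*, Ann. of Math. (2) 77 (1963), Lemma 5.6
  and its proof (pp. 514–516). doi:10.2307/1970128 [KervaireMilnorAnnals1963]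
-/


open AddSubgroup

namespace Literature.GroupTheory.FiniteAbelian

/-- **Two quotients of one group by two cyclic kernels have isomorphic further quotients**
(the algebra of Kervaire–Milnor 1963, Lemma 5.6: "From this diagram the isomorphisms
`H_kM/λ(Z) ≅ H_kM₀/ε(Z) + ε'(Z) ≅ H_kM'/λ'(Z)` are apparent"): if `i : A → B` is onto with kernel
`mℤ` and `j : A → C` is onto with kernel `pℤ`, then `B/(i p)ℤ ≅ C/(j m)ℤ`, both being
`A/(mℤ + pℤ)`. [cite: KervaireMilnorAnnals1963, Lemma 5.6, end of proof (p. 516)] -/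
theorem nonempty_quotient_zmultiples_addEquiv_of_ker_eq {A B C : Type*} [AddCommGroup A]
    [AddCommGroup B] [AddCommGroup C] {i : A →+ B} {j : A →+ C} (hi : Function.Surjective i)
    (hj : Function.Surjective j) {m p : A} (hki : i.ker = zmultiples m) (hkj : j.ker = zmultiples p) :
    Nonempty (B ⧸ zmultiples (i p) ≃+ C ⧸ zmultiples (j m)) := by
  -- both quotients are `A ⧸ (mℤ ⊔ pℤ)`
  let qB : A →+ B ⧸ zmultiples (i p) := (QuotientAddGroup.mk' _).comp i
  let qC : A →+ C ⧸ zmultiples (j m) := (QuotientAddGroup.mk' _).comp j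
  have hqB : Function.Surjective qB := (QuotientAddGroup.mk'_surjective _).comp hi
  have hqC : Function.Surjective qC := (QuotientAddGroup.mk'_surjective _).comp hj
  have hkB : qB.ker = zmultiples m ⊔ zmultiples p := by
    ext x
    rw [AddMonoidHom.mem_ker, AddMonoidHom.comp_apply, QuotientAddGroup.mk'_apply,
      QuotientAddGroup.eq_zero_iff, mem_zmultiples_iff, AddSubgroup.mem_sup]
    constructor
    · rintro ⟨n, hn⟩
      rw [← map_zsmul, eq_comm, ← sub_eq_zero, ← map_sub, ← AddMonoidHom.mem_ker, hki] at hn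
      exact ⟨x - n • p, hn, n • p, ⟨n, rfl⟩, sub_add_cancel _ _⟩
    · rintro ⟨y, hy, z, ⟨n, rfl⟩, rfl⟩
      refine ⟨n, ?_⟩
      have hy0 : i y = 0 := by rw [← AddMonoidHom.mem_ker, hki]; exact hy
      dsimp only
      rw [map_add, hy0, zero_add, map_zsmul]
  have hkC : qC.ker = zmultiples m ⊔ zmultiples p := by
    ext x
    rw [AddMonoidHom.mem_ker, AddMonoidHom.comp_apply, QuotientAddGroup.mk'_apply,
      QuotientAddGroup.eq_zero_iff, mem_zmultiples_iff, AddSubgroup.mem_sup]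
    constructor
    · rintro ⟨n, hn⟩
      rw [← map_zsmul, eq_comm, ← sub_eq_zero, ← map_sub, ← AddMonoidHom.mem_ker, hkj] at hn
      exact ⟨n • m, ⟨n, rfl⟩, x - n • m, hn, add_sub_cancel _ _⟩
    · rintro ⟨y, ⟨n, rfl⟩, z, hz, rfl⟩
      refine ⟨n, ?_⟩
      have hz0 : j z = 0 := by rw [← AddMonoidHom.mem_ker, hkj]; exact hz
      dsimp only
      rw [map_add, hz0, add_zero, map_zsmul]
  exact ⟨((QuotientAddGroup.quotientKerEquivOfSurjective qB hqB).symm.trans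
    (QuotientAddGroup.quotientAddEquivOfEq (hkB.trans hkC.symm))).trans
    (QuotientAddGroup.quotientKerEquivOfSurjective qC hqC)⟩

/-- **The kernel of one component of a Mayer–Vietoris map from a two-generator group** (the
diagram chase behind the exact sequences of Kervaire–Milnor 1963, Lemma 5.6): let
`I → U ⊕ W → Y → 0` be exact in the sense that `u (a₁ z) = w (a₂ z)` for all `z`, every `y` is
`u x + w v`, and `u x + w v = 0` forces `(x, v) = (a₁ z, -a₂ z)`; suppose `I` is generated by
`m` and `p`, `a₂ m = 0`, and every element of `W` is a multiple of `a₂ p`, an element of infinite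
order. Then `u : U → Y` is onto with kernel exactly `(a₁ m)ℤ`.
[cite: KervaireMilnorAnnals1963, Lemma 5.6, proof (pp. 515–516)] -/
theorem surjective_and_ker_eq_zmultiples_of_mayerVietoris {I U W Y : Type*} [AddCommGroup I]
    [AddCommGroup U] [AddCommGroup W] [AddCommGroup Y] (a₁ : I →+ U) (a₂ : I →+ W) (u : U →+ Y)
    (w : W →+ Y) (hcomp : ∀ z, u (a₁ z) = w (a₂ z))
    (hsurj : ∀ y, ∃ (x : U) (v : W), u x + w v = y)
    (hexact : ∀ (x : U) (v : W), u x + w v = 0 → ∃ z, a₁ z = x ∧ -a₂ z = v)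
    {m p : I} (hgen : ∀ z : I, ∃ c₁ c₂ : ℤ, z = c₁ • m + c₂ • p) (hm : a₂ m = 0)
    (hW : ∀ v : W, ∃ c : ℤ, v = c • a₂ p) (hp : ∀ c : ℤ, c • a₂ p = 0 → c = 0) :
    Function.Surjective u ∧ u.ker = zmultiples (a₁ m) := by
  refine ⟨fun y => ?_, ?_⟩
  · obtain ⟨x, v, rfl⟩ := hsurj y
    obtain ⟨c, rfl⟩ := hW v
    exact ⟨x + c • a₁ p, by rw [map_add, map_zsmul, hcomp, map_zsmul]⟩
  · ext x
    rw [AddMonoidHom.mem_ker, mem_zmultiples_iff]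
    constructor
    · intro hx
      obtain ⟨z, hz1, hz2⟩ := hexact x 0 (by rw [hx, map_zero, add_zero])
      obtain ⟨c₁, c₂, rfl⟩ := hgen z
      have hc₂ : c₂ = 0 := by
        apply hp
        have h2 := hz2
        rw [map_add, map_zsmul, map_zsmul, hm, smul_zero, zero_add, neg_eq_zero] at h2
        exact h2
      subst hc₂
      rw [zero_smul, add_zero, map_zsmul] at hz1
      exact ⟨c₁, hz1⟩
    · rintro ⟨c, rfl⟩
      rw [map_zsmul, hcomp, hm, map_zero, smul_zero]

end Literature.GroupTheory.FiniteAbelian
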